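import Literature.Analysis.ValidatedNumerics.KrawczykOptimalPreconditioner
import Literature.LinearAlgebra.Matrix.ZMatrixSemipositive
import HarnessLib

/-!
# The interval inverse `Aᴵ b = (I + (I − R)⁻¹R[−1, 1])(C b)` from a Krawczyk test
# (Neumaier 1990, §5.1 Proposition 5.1.10, formula (16) and inclusion (17))

Topic `Literature/Analysis/ValidatedNumerics`.  Published results only, each with its citation tag.

Setting of `KrawczykOptimalPreconditioner.lean`: a box `x = [l, u]` with midpoint `x̌`, an interval matrix
`A = [A̲, Ā]`, a preconditioner `C`, a map `F`, the exact Krawczyk set `K(x, x̌; C) = krawczykSet …` and the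
magnitude matrix `R := |CA − I|` (`krawczykMag`).  Proposition 5.1.10 (Krawczyk) says that when the test
`K(x, x̌) ⊆ int(x)` succeeds, the data already computed yield more than the enclosure: `ρ(R) < 1`, every
`Ã ∈ A` is nonsingular (both in `KrawczykOptimalPreconditioner.lean`), **formula (16)**
`Aᴵ b := (I + (I − R)⁻¹ R [−1, 1])(C b)` *defines an inverse of `A`* (an interval operator enclosing
`Ã⁻¹ b̃` for all `Ã ∈ A`, `b̃ ∈ b`, §3.5), and **(17)** `x̌ − Aᴵ F(x̌) ⊆ K(x, x̌)` — the Newton-type operator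
built from `Aᴵ` is at least as sharp as Krawczyk's.  This file proves:

* §1 **`I − R` is a semipositive Z-matrix**: `R ≥ 0`, and `d := rad(x) = u − x̌ > 0` satisfies
  `(I − R) d > 0` (Neumaier: "`rad(x) > R·rad(x) ≥ 0`; hence `ρ(R) < 1`"); therefore `I − R` is nonsingular
  and `(I − R)⁻¹ ≥ 0` (`isUnit_det_one_sub_mag`, `inv_one_sub_mag_nonneg`) — obtained here from the
  inverse-positivity of semipositive Z-matrices (`Literature.LinearAlgebra.Matrix.ZMatrixSemipositive`,
  Berman–Plemmons (I₂₇) ⇒ (N₃₈)) instead of the Neumann series `Σ Rᵏ`.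
* §2 **`|(CÃ)⁻¹ − I| ≤ (I − R)⁻¹ R` for every `Ã ∈ A`** (`abs_inv_mul_sub_one_le`; the matrix
  `(I − R)⁻¹R` is `invDefect`), i.e. `(CÃ)⁻¹ ∈ I + (I − R)⁻¹R[−1, 1]` — the step of the proof from `|R̃| ≤ R`,
  `R̃ := CÃ − I`; typed through the identity `E = −R̃(I + E)` for `E := (CÃ)⁻¹ − I` and the comparison
  principle for `I − R`.  Consequence for a thin right-hand side: `|Ã⁻¹ b − C b| ≤ (I − R)⁻¹R |C b|`
  (`abs_inv_mulVec_sub_le`).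
* §3 **(16) defines an inverse of `A`**: with `Aᴵ` rendered as the exact set `invOpSet ((I − R)⁻¹R) (C b)`
  (rows `(T y)ᵢ`, `|T − I| ≤ (I − R)⁻¹R`, `y ∈ C b`, the interval vector `C b = mulBox C b̌ r` of a box
  `b = [b̌ − r, b̌ + r]`), every solution `Ã⁻¹ b̃`, `Ã ∈ A`, `b̃ ∈ b`, lies in `Aᴵ b` (`inv_mulVec_mem_invOpSet`)
  — the defining inclusion `Aᴴ b ⊆ Aᴵ b` of an inverse of an interval matrix (§3.5, Example 3.5.1 (iv)).
* §4 **Inclusion (17)**: `|C F(x̌)| ≤ (I − R) rad(x)` (`abs_mulVec_apply_le`), hence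
  `rad(z) = (I − R)⁻¹R |C F(x̌)| ≤ R rad(x) = rad(y)` (`invDefect_mulVec_abs_le`) and, since both boxes are
  centred at `x̌ − C F(x̌)`, `x̌ − z ∈ K(x, x̌)` for every `z ∈ Aᴵ F(x̌)` (`sub_mem_krawczykSet_of_mem_invOpSet`).

Honest scope.  (i) The book derives `(I − R)⁻¹R ≥ 0` and `|(I + R̃)⁻¹ − I| ≤ (I − R)⁻¹R` from `ρ(R) < 1`
and the Neumann series; we neither formalise the spectral radius nor the series and argue instead with the
positive vector `d = rad(x)` (`‖R‖_d < 1`, `KrawczykOptimalPreconditioner.exists_scaledNormLE_lt_one`) and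
M-matrix monotonicity — the conclusions are the printed ones.  (ii) "Inverse of `A`" (§3.5) means a
*sublinear* map `b ↦ Aᴵ b` with `Aᴴ b ⊆ Aᴵ b`; we type the inclusion (pointwise: every `Ã⁻¹ b̃ ∈ Aᴵ b`,
which is what makes the hull `Aᴴ b` lie in the box `Aᴵ b`) and do not restate the sublinearity axioms
(S1)–(S3), which are properties of interval arithmetic.  (iii) (17) concerns the thin argument `b = F(x̌)`,
for which `C b = {C F(x̌)}`; the interval operators are rendered as exact sets (as in `KrawczykOperator.lean`),
so "`z ⊆ y`" is typed as membership of every point.  (iv) Not restated: the use of `Aᴵ` in the iterations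
of §5.2 (Thms 5.2.8, 5.2.12) and Remark (ii) after Thm 5.1.9.

References: [Neumaier1991] A. Neumaier, *Interval Methods for Systems of Equations*, Encyclopedia of
Mathematics and its Applications 37, CUP 1990, Prop. 5.1.10 with its proof, formulas (16)–(17) (held copy:
text chunk 168 of the store key `book:neumaier1991-interval-methods-systems-equations`), §3.5 before
Prop. 3.5.2 (sublinear maps; "an inverse of `A ∈ 𝕀ℝⁿˣⁿ`", chunks 97–98), §3.1 (interval matrix–vector
operations); [BermanPlemmons1994] A. Berman, R. J. Plemmons, *Nonnegative Matrices in the Mathematical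
Sciences*, SIAM 1994, Ch. 6 Thm 2.3 (via `ZMatrixSemipositive.lean`).
-/

open Set Matrix
open Literature.Analysis.ValidatedNumerics.KrawczykOptimal
open Literature.LinearAlgebra.Matrix (IsZMatrix)

namespace Literature.Analysis.ValidatedNumerics.KrawczykInverse

variable {n : ℕ}

/-! ### §1. `I − R` is a semipositive Z-matrix when `K(x, x̌) ⊆ int(x)`; hence `(I − R)⁻¹ ≥ 0` -/

section MMatrix

variable {Al Au C : Matrix (Fin n) (Fin n) ℝ} {F : (Fin n → ℝ) → Fin n → ℝ} {l u xt : Fin n → ℝ}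

/-- `R = |CA − I| ≥ 0` entrywise (`A̲ ≤ Ā`). [folklore] -/
private theorem mag_nonneg (hA : ∀ i j, Al i j ≤ Au i j) (i j : Fin n) :
    0 ≤ krawczykMag Al Au C i j := by
  simp only [krawczykMag]
  refine add_nonneg (abs_nonneg _) (Finset.sum_nonneg fun k _ => mul_nonneg (abs_nonneg _) ?_)
  simp only [radMatrix]
  linarith [hA k j]

/-- With the midpoint centre, `rad(x) = u − x̌ ≥ 0`. [folklore] -/
private theorem rad_nonneg (hlu : l ≤ u) (hmid : ∀ j, xt j - l j = u j - xt j) (j : Fin n) :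
    0 ≤ (u - xt) j := by
  rw [Pi.sub_apply]; linarith [hmid j, hlu j]

/-- **`I − R` is a Z-matrix** (`R := |CA − I| ≥ 0`, so the off-diagonal entries of `I − R` are `≤ 0`).
[cite: Neumaier1991, Prop 5.1.10 (proof: (I − R)⁻¹ R ≥ 0)] -/
theorem isZMatrix_one_sub_mag (hA : ∀ i j, Al i j ≤ Au i j) :
    IsZMatrix (1 - krawczykMag Al Au C) := by
  intro i j hij
  rw [Matrix.sub_apply, Matrix.one_apply_ne hij, zero_sub, neg_nonpos]
  exact mag_nonneg hA i j

/-- **`(I − R) rad(x) > 0`** when `K(x, x̌) ⊆ int(x)`: the vector `d = rad(x) = u − x̌` exhibits `I − R` as a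
semipositive Z-matrix (Neumaier: `rad(x) > R·rad(x) ≥ 0`, "hence `ρ(R) < 1`").
[cite: Neumaier1991, Prop 5.1.10 (proof: rad(x) > R·rad(x) ≥ 0)] -/
theorem one_sub_mag_mulVec_rad_pos (hA : ∀ i j, Al i j ≤ Au i j) (hlu : l ≤ u)
    (hmid : ∀ j, xt j - l j = u j - xt j)
    (hK : krawczykSet (matrixIcc Al Au) C F xt (Icc l u) ⊆ interior (Icc l u)) (i : Fin n) :
    0 < ((1 - krawczykMag Al Au C) *ᵥ (u - xt)) i := by
  have h := mag_mulVec_rad_lt_rad hA hlu hmid hK i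
  rw [Matrix.sub_mulVec, Matrix.one_mulVec, Pi.sub_apply, Pi.sub_apply]
  linarith

/-- `rad(x) > 0` componentwise when `K(x, x̌) ⊆ int(x)` (`rad(x)ᵢ > (R rad(x))ᵢ ≥ 0`). [folklore] -/
private theorem rad_pos (hA : ∀ i j, Al i j ≤ Au i j) (hlu : l ≤ u)
    (hmid : ∀ j, xt j - l j = u j - xt j)
    (hK : krawczykSet (matrixIcc Al Au) C F xt (Icc l u) ⊆ interior (Icc l u)) (i : Fin n) :
    0 < (u - xt) i := by
  have h := mag_mulVec_rad_lt_rad hA hlu hmid hK i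
  have h0 : 0 ≤ (krawczykMag Al Au C *ᵥ (u - xt)) i := by
    simp only [Matrix.mulVec, dotProduct]
    exact Finset.sum_nonneg fun j _ => mul_nonneg (mag_nonneg hA i j) (rad_nonneg hlu hmid j)
  rw [Pi.sub_apply]
  linarith

/-- **`I − R` is nonsingular** when `K(x, x̌) ⊆ int(x)` (a semipositive Z-matrix; Berman–Plemmons
(I₂₇)). [cite: Neumaier1991, Prop 5.1.10 ((I − R)⁻¹ in (16))] -/
theorem isUnit_det_one_sub_mag (hA : ∀ i j, Al i j ≤ Au i j) (hlu : l ≤ u)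
    (hmid : ∀ j, xt j - l j = u j - xt j)
    (hK : krawczykSet (matrixIcc Al Au) C F xt (Icc l u) ⊆ interior (Icc l u)) :
    IsUnit (1 - krawczykMag Al Au C).det :=
  (isZMatrix_one_sub_mag hA).isUnit_det_of_semipositive (rad_pos hA hlu hmid hK)
    (one_sub_mag_mulVec_rad_pos hA hlu hmid hK)

/-- **`(I − R)⁻¹ ≥ 0` entrywise** when `K(x, x̌) ⊆ int(x)` (Neumaier obtains it from `ρ(R) < 1` as the
Neumann series `Σ Rᵏ`; here from the inverse-positivity of semipositive Z-matrices, Berman–Plemmons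
(I₂₇) ⇒ (N₃₈)). [cite: Neumaier1991, Prop 5.1.10 ((I − R)⁻¹ R in (16))] -/
theorem inv_one_sub_mag_nonneg (hA : ∀ i j, Al i j ≤ Au i j) (hlu : l ≤ u)
    (hmid : ∀ j, xt j - l j = u j - xt j)
    (hK : krawczykSet (matrixIcc Al Au) C F xt (Icc l u) ⊆ interior (Icc l u)) (i j : Fin n) :
    0 ≤ (1 - krawczykMag Al Au C)⁻¹ i j :=
  (isZMatrix_one_sub_mag hA).inv_nonneg_of_semipositive (rad_pos hA hlu hmid hK)
    (one_sub_mag_mulVec_rad_pos hA hlu hmid hK) i j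

end MMatrix

/-! ### §2. The matrix `(I − R)⁻¹ R` and the enclosure `|(CÃ)⁻¹ − I| ≤ (I − R)⁻¹ R` -/

section Defect

variable (Al Au C : Matrix (Fin n) (Fin n) ℝ)

/-- The nonnegative matrix **`(I − R)⁻¹ R`** of (16) (`= Σ_{k ≥ 1} Rᵏ` when `ρ(R) < 1`), `R := |CA − I|`: the
radius of the interval matrix `I + (I − R)⁻¹ R [−1, 1]` enclosing every `(CÃ)⁻¹`, `Ã ∈ A`.
[cite: Neumaier1991, Prop 5.1.10 (16)] -/
noncomputable def invDefect : Matrix (Fin n) (Fin n) ℝ :=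
  (1 - krawczykMag Al Au C)⁻¹ * krawczykMag Al Au C

variable {Al Au C} {F : (Fin n → ℝ) → Fin n → ℝ} {l u xt : Fin n → ℝ}

/-- `(I − R)⁻¹ R ≥ 0` entrywise. [cite: Neumaier1991, Prop 5.1.10 (16)] -/
theorem invDefect_nonneg (hA : ∀ i j, Al i j ≤ Au i j) (hlu : l ≤ u)
    (hmid : ∀ j, xt j - l j = u j - xt j)
    (hK : krawczykSet (matrixIcc Al Au) C F xt (Icc l u) ⊆ interior (Icc l u)) (i j : Fin n) :
    0 ≤ invDefect Al Au C i j := by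
  rw [invDefect, Matrix.mul_apply]
  exact Finset.sum_nonneg fun m _ =>
    mul_nonneg (inv_one_sub_mag_nonneg hA hlu hmid hK i m) (mag_nonneg hA m j)

/-- `(I − R) · (I − R)⁻¹ R = R`. [folklore] -/
private theorem one_sub_mag_mul_invDefect (hdet : IsUnit (1 - krawczykMag Al Au C).det) :
    (1 - krawczykMag Al Au C) * invDefect Al Au C = krawczykMag Al Au C := by
  rw [invDefect, ← Matrix.mul_assoc, Matrix.mul_nonsing_inv _ hdet, Matrix.one_mul]

/-- `C Ã ∈ C·A` for `Ã ∈ A` (take the same `Ã` in every entry). [folklore] -/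
private theorem mul_mem_imulSet {M : Matrix (Fin n) (Fin n) ℝ} (hM : M ∈ matrixIcc Al Au) :
    C * M ∈ imulSet C (matrixIcc Al Au) :=
  fun _ _ => ⟨M, hM, rfl⟩

/-- **`(CÃ)⁻¹ ∈ I + (I − R)⁻¹ R [−1, 1]` for every `Ã ∈ A`** (proof of Prop. 5.1.10: "if `Ã ∈ A` then
`R̃ := CÃ − I` satisfies `|R̃| ≤ R`; hence `|(CÃ)⁻¹ − I| ≤ (I − R)⁻¹ R`").  Typed without the Neumann series:
`E := (CÃ)⁻¹ − I` satisfies `E = −R̃ (I + E)`, so each column of `|E|` obeys `(I − R)|E|_{·j} ≤ R_{·j} =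
(I − R)((I − R)⁻¹R)_{·j}` and the comparison principle for the semipositive Z-matrix `I − R` gives
`|E| ≤ (I − R)⁻¹ R`.  (`CÃ` is nonsingular by Prop. 5.1.10, `det_ne_zero_of_subset_interior`.)
[cite: Neumaier1991, Prop 5.1.10 (proof: |(CÃ)⁻¹ − I| ≤ (I − R)⁻¹ R)] -/
theorem abs_inv_mul_sub_one_le (hA : ∀ i j, Al i j ≤ Au i j) (hlu : l ≤ u)
    (hmid : ∀ j, xt j - l j = u j - xt j)
    (hK : krawczykSet (matrixIcc Al Au) C F xt (Icc l u) ⊆ interior (Icc l u))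
    {M : Matrix (Fin n) (Fin n) ℝ} (hM : M ∈ matrixIcc Al Au) (i j : Fin n) :
    |((C * M)⁻¹ - 1) i j| ≤ invDefect Al Au C i j := by
  set R := krawczykMag Al Au C with hR
  set P := C * M with hP
  obtain ⟨hdetM, hdetC⟩ := det_ne_zero_of_subset_interior hA hlu hmid hK hM
  have hPu : IsUnit P.det := by
    rw [hP, Matrix.det_mul]
    exact isUnit_iff_ne_zero.mpr (mul_ne_zero hdetC hdetM)
  have hRt : ∀ a b, |(P - 1) a b| ≤ R a b :=
    fun a b => isKrawczykMagBound_krawczykMag Al Au C P (mul_mem_imulSet hM) a b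
  -- `E = −(P − I) P⁻¹`
  have hE : P⁻¹ - 1 = -((P - 1) * P⁻¹) := by
    rw [Matrix.sub_mul, Matrix.one_mul, Matrix.mul_nonsing_inv P hPu]
    abel
  -- column `j`: `|E|_{mj} ≤ R_{mj} + (R |E|_{·j})_m`
  have hcol : ∀ m, |(P⁻¹ - 1) m j| ≤ R m j + ∑ k, R m k * |(P⁻¹ - 1) k j| := fun m => by
    have h1 : (P⁻¹ - 1) m j = -∑ k, (P - 1) m k * P⁻¹ k j := by
      rw [hE, Matrix.neg_apply, Matrix.mul_apply]
    rw [h1, abs_neg]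
    refine (Finset.abs_sum_le_sum_abs _ _).trans ?_
    have h2 : ∀ k, |(P - 1) m k * P⁻¹ k j| ≤
        R m k * (1 : Matrix (Fin n) (Fin n) ℝ) k j + R m k * |(P⁻¹ - 1) k j| := fun k => by
      rw [abs_mul, ← mul_add]
      refine mul_le_mul (hRt m k) ?_ (abs_nonneg _) ((abs_nonneg _).trans (hRt m k))
      have h3 : P⁻¹ k j = (1 : Matrix (Fin n) (Fin n) ℝ) k j + (P⁻¹ - 1) k j := by
        rw [Matrix.sub_apply]; ring
      rw [h3]
      refine (abs_add_le _ _).trans (add_le_add (le_of_eq ?_) le_rfl)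
      rw [Matrix.one_apply]
      split_ifs <;> simp
    refine (Finset.sum_le_sum fun k _ => h2 k).trans (le_of_eq ?_)
    rw [Finset.sum_add_distrib]
    congr 1
    simp only [Matrix.one_apply, mul_ite, mul_one, mul_zero, Finset.sum_ite_eq', Finset.mem_univ,
      if_true]
  -- comparison principle for `I − R` with the positive vector `rad(x)`
  have hZ := isZMatrix_one_sub_mag (C := C) hA
  have hdet := isUnit_det_one_sub_mag hA hlu hmid hK
  have hle := hZ.le_of_mulVec_le (rad_pos hA hlu hmid hK) (one_sub_mag_mulVec_rad_pos hA hlu hmid hK)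
    (v := fun m => |(P⁻¹ - 1) m j|) (w := fun m => invDefect Al Au C m j) (fun m => by
      have hw : ((1 - R) *ᵥ fun m => invDefect Al Au C m j) m = R m j := by
        have h := congrFun (congrFun (one_sub_mag_mul_invDefect (Al := Al) (Au := Au) (C := C) hdet) m) j
        rw [Matrix.mul_apply] at h
        simpa only [Matrix.mulVec, dotProduct, ← hR] using h
      have hv : ((1 - R) *ᵥ fun m => |(P⁻¹ - 1) m j|) m =
          |(P⁻¹ - 1) m j| - ∑ k, R m k * |(P⁻¹ - 1) k j| := by
        rw [Matrix.sub_mulVec, Matrix.one_mulVec, Pi.sub_apply]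
        simp only [Matrix.mulVec, dotProduct]
      rw [hw, hv]
      linarith [hcol m])
  exact hle i

/-- **Pointwise form of (16) for a thin right-hand side**: for `Ã ∈ A` and `b ∈ ℝⁿ`,
`|Ã⁻¹ b − C b| ≤ (I − R)⁻¹ R |C b|` componentwise, i.e. `Ã⁻¹ b ∈ Aᴵ b = (I + (I − R)⁻¹R[−1,1])(C b)`
(`Ã⁻¹ = (CÃ)⁻¹ C`). [cite: Neumaier1991, Prop 5.1.10 (16)] -/
theorem abs_inv_mulVec_sub_le (hA : ∀ i j, Al i j ≤ Au i j) (hlu : l ≤ u)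
    (hmid : ∀ j, xt j - l j = u j - xt j)
    (hK : krawczykSet (matrixIcc Al Au) C F xt (Icc l u) ⊆ interior (Icc l u))
    {M : Matrix (Fin n) (Fin n) ℝ} (hM : M ∈ matrixIcc Al Au) (b : Fin n → ℝ) (i : Fin n) :
    |(M⁻¹ *ᵥ b) i - (C *ᵥ b) i| ≤ (invDefect Al Au C *ᵥ fun j => |(C *ᵥ b) j|) i := by
  set P := C * M with hP
  obtain ⟨hdetM, hdetC⟩ := det_ne_zero_of_subset_interior hA hlu hmid hK hM
  have hPu : IsUnit P.det := by
    rw [hP, Matrix.det_mul]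
    exact isUnit_iff_ne_zero.mpr (mul_ne_zero hdetC hdetM)
  have hMinv : M⁻¹ = P⁻¹ * C :=
    Matrix.inv_eq_left_inv (by rw [Matrix.mul_assoc, ← hP, Matrix.nonsing_inv_mul P hPu])
  have h1 : (M⁻¹ *ᵥ b) i - (C *ᵥ b) i = ((P⁻¹ - 1) *ᵥ (C *ᵥ b)) i := by
    rw [hMinv, ← Matrix.mulVec_mulVec, Matrix.sub_mulVec, Matrix.one_mulVec, Pi.sub_apply]
  rw [h1]
  simp only [Matrix.mulVec, dotProduct]
  refine (Finset.abs_sum_le_sum_abs _ _).trans (Finset.sum_le_sum fun j _ => ?_)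
  rw [abs_mul]
  exact mul_le_mul_of_nonneg_right (abs_inv_mul_sub_one_le hA hlu hmid hK hM i j) (abs_nonneg _)

end Defect

/-! ### §3. Formula (16): `Aᴵ b := (I + (I − R)⁻¹ R [−1, 1])(C b)` is an inverse of `A` -/

section InverseOperator

variable {Al Au C : Matrix (Fin n) (Fin n) ℝ} {F : (Fin n → ℝ) → Fin n → ℝ} {l u xt : Fin n → ℝ}

/-- The **interval operator `Aᴵ`** of (16), as an exact set: for a set `Y ⊆ ℝⁿ` standing for the
interval vector `C b`, `Aᴵ` applied to it is `(I + Q[−1, 1]) Y` with `Q := (I − R)⁻¹ R`, rendered like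
`krawczykSet`: `z` belongs to it iff every row `i` is `(T y)ᵢ` for some `T` with `|T − I| ≤ Q` and some
`y ∈ Y` (rows evaluated independently — the interval evaluation of a matrix–vector product in which each
`yⱼ` occurs once per row is its exact range). [cite: Neumaier1991, Prop 5.1.10 (16)] -/
def invOpSet (Q : Matrix (Fin n) (Fin n) ℝ) (Y : Set (Fin n → ℝ)) : Set (Fin n → ℝ) :=
  {z | ∀ i, ∃ T ∈ matrixIcc (1 - Q) (1 + Q), ∃ y ∈ Y, z i = (T *ᵥ y) i}

/-- The interval vector **`C b`** for a box `b = [b̌ − r, b̌ + r]` (`r ≥ 0`): the box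
`[C b̌ − |C| r, C b̌ + |C| r]` (exact range of each component `Σⱼ Cᵢⱼ bⱼ`).
[cite: Neumaier1991, §3.1 (interval matrix–vector product)] -/
def mulBox (C : Matrix (Fin n) (Fin n) ℝ) (bc rb : Fin n → ℝ) : Set (Fin n → ℝ) :=
  Icc (C *ᵥ bc - fun i => ∑ j, |C i j| * rb j) (C *ᵥ bc + fun i => ∑ j, |C i j| * rb j)

/-- `C b̃ ∈ C b` for `b̃ ∈ b`. [cite: Neumaier1991, §3.1 (inclusion property of interval operations)] -/
theorem mulVec_mem_mulBox {bc rb bt : Fin n → ℝ} (hbt : ∀ j, |bt j - bc j| ≤ rb j) :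
    C *ᵥ bt ∈ mulBox C bc rb := by
  have h : ∀ i, |(C *ᵥ bt) i - (C *ᵥ bc) i| ≤ ∑ j, |C i j| * rb j := fun i => by
    rw [← Pi.sub_apply, ← Matrix.mulVec_sub]
    simp only [Matrix.mulVec, dotProduct]
    refine (Finset.abs_sum_le_sum_abs _ _).trans (Finset.sum_le_sum fun j _ => ?_)
    rw [abs_mul, Pi.sub_apply]
    exact mul_le_mul_of_nonneg_left (hbt j) (abs_nonneg _)
  refine ⟨fun i => ?_, fun i => ?_⟩
  · have := (abs_le.mp (h i)).1
    rw [Pi.sub_apply]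
    linarith
  · have := (abs_le.mp (h i)).2
    rw [Pi.add_apply]
    linarith

/-- **Proposition 5.1.10, (16) defines an inverse of `A`**: if `K(x, x̌) ⊆ int(x)` then for every
`Ã ∈ A` and every `b̃` of a box `b = [b̌ − r, b̌ + r]`, the solution `Ã⁻¹ b̃` lies in
`Aᴵ b = (I + (I − R)⁻¹ R [−1, 1])(C b)` — the defining inclusion `Aᴴ b ⊆ Aᴵ b` of an *inverse of `A`*
(§3.5, after Example 3.5.1 (iv)), pointwise.  Book: "`(CÃ)⁻¹ ∈ I + (I − R)⁻¹R[−1, 1]`. This shows that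
`Aᴵ b` is an inverse of `A`."  (The sublinearity axioms (S1)–(S3) of `b ↦ Aᴵ b`, properties of interval
arithmetic, are not restated.) [cite: Neumaier1991, Prop 5.1.10 (16) ("defines an inverse of A")]
[cite: Neumaier1991, §3.5 Example 3.5.1 (iv) (inverse of an interval matrix)] -/
theorem inv_mulVec_mem_invOpSet (hA : ∀ i j, Al i j ≤ Au i j) (hlu : l ≤ u)
    (hmid : ∀ j, xt j - l j = u j - xt j)
    (hK : krawczykSet (matrixIcc Al Au) C F xt (Icc l u) ⊆ interior (Icc l u))
    {M : Matrix (Fin n) (Fin n) ℝ} (hM : M ∈ matrixIcc Al Au) {bc rb bt : Fin n → ℝ}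
    (hbt : ∀ j, |bt j - bc j| ≤ rb j) :
    M⁻¹ *ᵥ bt ∈ invOpSet (invDefect Al Au C) (mulBox C bc rb) := by
  set P := C * M with hP
  obtain ⟨hdetM, hdetC⟩ := det_ne_zero_of_subset_interior hA hlu hmid hK hM
  have hPu : IsUnit P.det := by
    rw [hP, Matrix.det_mul]
    exact isUnit_iff_ne_zero.mpr (mul_ne_zero hdetC hdetM)
  have hMinv : M⁻¹ = P⁻¹ * C :=
    Matrix.inv_eq_left_inv (by rw [Matrix.mul_assoc, ← hP, Matrix.nonsing_inv_mul P hPu])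
  have hT : P⁻¹ ∈ matrixIcc (1 - invDefect Al Au C) (1 + invDefect Al Au C) := fun i j => by
    have h := abs_le.mp (abs_inv_mul_sub_one_le hA hlu hmid hK hM i j)
    rw [Matrix.sub_apply] at h
    rw [Matrix.sub_apply, Matrix.add_apply]
    constructor <;> linarith [h.1, h.2]
  intro i
  exact ⟨P⁻¹, hT, C *ᵥ bt, mulVec_mem_mulBox hbt, by rw [hMinv, Matrix.mulVec_mulVec]⟩

end InverseOperator

/-! ### §4. Inclusion (17): `x̌ − Aᴵ F(x̌) ⊆ K(x, x̌)` -/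

section Seventeen

variable {Al Au C : Matrix (Fin n) (Fin n) ℝ} {F : (Fin n → ℝ) → Fin n → ℝ} {l u xt : Fin n → ℝ}

/-- `|C F(x̌)| ≤ (I − R) rad(x)` from `K(x, x̌) ⊆ int(x)` (even `⊆ x`): the two vertices
`x̌ − C F(x̌) ± R rad(x)` of the exact box `K(x, x̌)` lie in `x`.
[cite: Neumaier1991, Prop 5.1.10 (proof: |CF(x̌)| = |x̌ − y̌| ≤ rad(x) − rad(y) = (I − R)rad(x))] -/
theorem abs_mulVec_apply_le (hA : ∀ i j, Al i j ≤ Au i j) (hlu : l ≤ u)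
    (hmid : ∀ j, xt j - l j = u j - xt j)
    (hK : krawczykSet (matrixIcc Al Au) C F xt (Icc l u) ⊆ Icc l u) (j : Fin n) :
    |(C *ᵥ F xt) j| ≤ (u - xt) j - (krawczykMag Al Au C *ᵥ (u - xt)) j := by
  set R := krawczykMag Al Au C with hR
  have hρ : ∀ i, 0 ≤ (R *ᵥ (u - xt)) i := fun i => by
    simp only [Matrix.mulVec, dotProduct]
    exact Finset.sum_nonneg fun k _ => mul_nonneg (mag_nonneg hA i k) (rad_nonneg hlu hmid k)
  have hbox := krawczykSet_midpoint_eq_Icc (C := C) (F := F) hA hlu hmid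
  have hp : xt - C *ᵥ F xt + R *ᵥ (u - xt) ∈ krawczykSet (matrixIcc Al Au) C F xt (Icc l u) := by
    rw [hbox]
    refine ⟨fun i => ?_, le_rfl⟩
    rw [Pi.sub_apply (xt - C *ᵥ F xt), Pi.add_apply (xt - C *ᵥ F xt)]
    linarith [hρ i]
  have hm : xt - C *ᵥ F xt - R *ᵥ (u - xt) ∈ krawczykSet (matrixIcc Al Au) C F xt (Icc l u) := by
    rw [hbox]
    refine ⟨le_rfl, fun i => ?_⟩
    rw [Pi.sub_apply (xt - C *ᵥ F xt), Pi.add_apply (xt - C *ᵥ F xt)]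
    linarith [hρ i]
  have h1 := (hK hp).2 j
  have h2 := (hK hm).1 j
  rw [Pi.add_apply (xt - C *ᵥ F xt), Pi.sub_apply] at h1
  rw [Pi.sub_apply (xt - C *ᵥ F xt), Pi.sub_apply] at h2
  rw [Pi.sub_apply, abs_le]
  constructor <;> linarith [hmid j]

/-- **`rad(z) = (I − R)⁻¹ R |C F(x̌)| ≤ R rad(x) = rad(y)`** (proof of (17)): from
`|C F(x̌)| ≤ (I − R) rad(x)` one gets `R |CF(x̌)| ≤ (I − R) R rad(x)`, and the comparison principle for
the semipositive Z-matrix `I − R` yields the claim. [cite: Neumaier1991, Prop 5.1.10 (proof of (17))] -/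
theorem invDefect_mulVec_abs_le (hA : ∀ i j, Al i j ≤ Au i j) (hlu : l ≤ u)
    (hmid : ∀ j, xt j - l j = u j - xt j)
    (hK : krawczykSet (matrixIcc Al Au) C F xt (Icc l u) ⊆ interior (Icc l u)) (i : Fin n) :
    (invDefect Al Au C *ᵥ fun j => |(C *ᵥ F xt) j|) i ≤ (krawczykMag Al Au C *ᵥ (u - xt)) i := by
  set R := krawczykMag Al Au C with hR
  set c : Fin n → ℝ := fun j => |(C *ᵥ F xt) j| with hc
  set d : Fin n → ℝ := u - xt with hd
  have hdet := isUnit_det_one_sub_mag hA hlu hmid hK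
  have hZ := isZMatrix_one_sub_mag (C := C) hA
  have hcle : ∀ j, c j ≤ ((1 - R) *ᵥ d) j := fun j => by
    rw [hc, hd, Matrix.sub_mulVec, Matrix.one_mulVec, Pi.sub_apply]
    exact abs_mulVec_apply_le hA hlu hmid (hK.trans interior_subset) j
  refine hZ.le_of_mulVec_le (rad_pos hA hlu hmid hK) (one_sub_mag_mulVec_rad_pos hA hlu hmid hK)
    (v := invDefect Al Au C *ᵥ c) (w := R *ᵥ d) (fun m => ?_) i
  -- `(I − R)(Q c) = R c ≤ R (I − R) d = (I − R)(R d)`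
  have hl : ((1 - R) *ᵥ (invDefect Al Au C *ᵥ c)) m = (R *ᵥ c) m := by
    rw [Matrix.mulVec_mulVec, one_sub_mag_mul_invDefect hdet]
  have hcomm : (1 - R) * R = R * (1 - R) := by
    rw [Matrix.sub_mul, Matrix.mul_sub, Matrix.one_mul, Matrix.mul_one]
  have hr : ((1 - R) *ᵥ (R *ᵥ d)) m = (R *ᵥ ((1 - R) *ᵥ d)) m := by
    rw [Matrix.mulVec_mulVec, Matrix.mulVec_mulVec, hcomm]
  rw [hl, hr]
  simp only [Matrix.mulVec, dotProduct]
  exact Finset.sum_le_sum fun j _ => mul_le_mul_of_nonneg_left (by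
    simpa only [Matrix.mulVec, dotProduct] using hcle j) (mag_nonneg hA m j)

/-- **Proposition 5.1.10, inclusion (17): `x̌ − Aᴵ F(x̌) ⊆ K(x, x̌)`.**  With the thin right-hand side
`b = F(x̌)` (so `C b = {C F(x̌)}`), every point `x̌ − z`, `z ∈ Aᴵ F(x̌)`, lies in `K(x, x̌)`: `z = T (C F(x̌))`
with `|T − I| ≤ (I − R)⁻¹R`, hence `|x̌ − z − y̌| ≤ (I − R)⁻¹R |CF(x̌)| ≤ R rad(x) = rad(y)` for the exact box
`y = K(x, x̌)` (Neumaier: "since `y̌ = ž`, this shows that `z ⊆ y`" — the computable Newton-type operator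
`x̌ − Aᴵ F(x̌)` is at least as good as the Krawczyk operator).
[cite: Neumaier1991, Prop 5.1.10 (17)] -/
theorem sub_mem_krawczykSet_of_mem_invOpSet (hA : ∀ i j, Al i j ≤ Au i j) (hlu : l ≤ u)
    (hmid : ∀ j, xt j - l j = u j - xt j)
    (hK : krawczykSet (matrixIcc Al Au) C F xt (Icc l u) ⊆ interior (Icc l u))
    {z : Fin n → ℝ} (hz : z ∈ invOpSet (invDefect Al Au C) {C *ᵥ F xt}) :
    xt - z ∈ krawczykSet (matrixIcc Al Au) C F xt (Icc l u) := by
  set R := krawczykMag Al Au C with hR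
  have hQ := invDefect_mulVec_abs_le hA hlu hmid hK
  have hdev : ∀ i, |z i - (C *ᵥ F xt) i| ≤ (invDefect Al Au C *ᵥ fun j => |(C *ᵥ F xt) j|) i := by
    intro i
    obtain ⟨T, hT, y, hy, hzi⟩ := hz i
    rw [Set.mem_singleton_iff] at hy
    have hzi' : z i - (C *ᵥ F xt) i = ((T - 1) *ᵥ (C *ᵥ F xt)) i := by
      rw [hzi, hy, Matrix.sub_mulVec, Matrix.one_mulVec, Pi.sub_apply]
    rw [hzi']
    simp only [Matrix.mulVec, dotProduct]
    refine (Finset.abs_sum_le_sum_abs _ _).trans (Finset.sum_le_sum fun j _ => ?_)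
    rw [abs_mul]
    have h := hT i j
    rw [Matrix.sub_apply, Matrix.add_apply] at h
    have hTij : |(T - 1) i j| ≤ invDefect Al Au C i j := by
      rw [Matrix.sub_apply, abs_le]
      constructor <;> linarith [h.1, h.2]
    exact mul_le_mul_of_nonneg_right hTij (abs_nonneg _)
  rw [krawczykSet_midpoint_eq_Icc hA hlu hmid]
  refine ⟨fun i => ?_, fun i => ?_⟩
  · have h := (abs_le.mp ((hdev i).trans (hQ i))).2
    rw [Pi.sub_apply (xt - C *ᵥ F xt), Pi.sub_apply, Pi.sub_apply]
    linarith
  · have h := (abs_le.mp ((hdev i).trans (hQ i))).1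
    rw [Pi.add_apply (xt - C *ᵥ F xt), Pi.sub_apply, Pi.sub_apply]
    linarith

end Seventeen

end Literature.Analysis.ValidatedNumerics.KrawczykInverse
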